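import Literature.Computability.AlgebraicComplexity.BD17DescartesCircuitsProofs
import Literature.Computability.AlgebraicComplexity.BD17OrderingExistsProofs
import HarnessLib

/-!
# Bihan–Dickenstein 2017, §3 from the main theorem: Thm. 3.3 (signature bound) ⇐ Thm. 2.9 — PROVED

F. Bihan, A. Dickenstein, *Descartes' rule of signs for polynomial systems supported on circuits*,
Int. Math. Res. Not. IMRN 2017 (22) 6867–6893 = arXiv:1601.05826 [BihanDickenstein2017], §2.2
(Lemma 2.2), §2.3 (the classes `K_j`), §3 (Thm. 3.3); held text `paper:arxiv-1601.05826`, printed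
numbering (flat "Lemma 2" = Lemma 2.2, "Theorem 16" = Thm. 3.3; concordance
`pub/val-lit/lit/CONCORDANCE-printed.md § BD17`). THEOREMS ONLY; sibling of the statement file
`BD17DescartesCircuits.lean` (cell `val-lit`, row X4-BD17), whose named facts are NOT restated. With
this file the whole of §3 of the paper hangs BY NAME on the main theorem `BD2017_thm_2_9` alone:

* `BD2017_thm_3_3_of_thm_2_9 : BD2017_thm_2_9 → BD2017_thm_3_3` (**Thm. 3.3 from Thm. 2.9**, proof
  as printed, p0009:L59–L84);
* `BD2017_cor_3_1_of_thm_2_9' : BD2017_thm_2_9 → BD2017_cor_3_1` (the tree's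
  `BD2017_cor_3_1_of_thm_2_9` fed with `BD2017_prop_2_6_holds`);
* `BD2017_cor_3_4_of_thm_2_9 : BD2017_thm_2_9 → BD2017_cor_3_4` (the tree's
  `BD2017_cor_3_4_of_thm_3_3` after `BD2017_thm_3_3_of_thm_2_9`).

The printed proof of Thm. 3.3 (p0009:L59–L84) is followed step by step:

1. "Let `α` be a bijection certifying the ordering property for `C` and let `K` be a maximal subset as
   before" — `BD2017_prop_2_6_holds` (tree) and `BD17.exists_isMaxMinorSet`; "By Theorem 2.9, we have
   that `n_𝒜(C)` is bounded by `sgnvar(λ̄_0, …, λ̄_{k−1})`" — the hypothesis `BD2017_thm_2_9`, (2.15).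
2. "if the value of `λ̄_j` is [positive] then `K_j ∩ ℵ₊ ≠ ∅` … Therefore, the number `n₊` of positive
   (resp. `n₋` of negative) terms … is at most `a₊` (resp. `a₋`)" — this uses that the classes `K_j`
   (2.12) PARTITION `[n+2]` ("by the maximality of `K` and Lemma 2.2", p0007:L23), which we prove:
   **Lemma 2.2 (i)** `BD17.span_cols_erase_eq_top` (a rank-`n` matrix with a positive kernel vector is
   not a pyramid, proof as printed p0006:L1–L8) and **Lemma 2.2 (iii)** `BD17.coeffMinor_ne_zero_or`
   (proof p0006:L14–L19, phrased through linear independence of columns: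
   `BD17.coeffMinor_ne_zero_iff`), whence `BD17.disjoint_minorClass`, and the counts
   `BD17.card_filter_lambdaBar_pos_le_sigPos` / `…_neg_le_sigNeg`.
3. "So its sign variation is at most `2 min{n₊, n₋} ≤ 2σ(𝒜)` … If `min{n₊, n₋} = σ(𝒜)`, then
   `n₊ = n₋ = σ(𝒜)` and then `sgnvar ≤ 2σ(𝒜) − 1`" — the elementary sign-variation counts
   `signVar_le_two_mul_countP_pos/neg`, `signVar_le_countP_add_countP_sub_one` (for the tree's
   `Literature.Algebra.Polynomial.signVar`, Basu–Pollack–Roy Notation 2.32, CITED not restated).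
4. "In case `n_𝒜(C) = n + 1` … `k = n + 2` and therefore `C` is uniform" — `sgnvar(s_α) ≤ k − 1`
   (`signVar_le_length_sub_one`, tree) and `a₊ + a₋ = n + 2` (`BD17.sigPos_add_sigNeg`, circuits).

Honest framing: a typed-literature companion (LADDER-VALIANT V1 ideation source: the signature bound
for positive solutions of circuit systems); nothing here bears on VP versus VNP.

## References

* [BihanDickenstein2017] F. Bihan, A. Dickenstein, IMRN 2017 (22) 6867–6893; arXiv:1601.05826,
  Lemma 2.2, §2.3 eq. (2.12)–(2.14), Thm. 2.9, Cor. 3.1, Thm. 3.3, Cor. 3.4.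
* [BasuPollackRoy2006] S. Basu, R. Pollack, M.-F. Roy, *Algorithms in Real Algebraic Geometry*,
  Notation 2.32 (the sign variation `Var`, the tree's `signVar`).
-/

noncomputable section

open Matrix Finset
open Literature.Algebra.Polynomial (signVar signVarAux)

namespace Literature.Computability.AlgebraicComplexity

/-! ### Sign variation versus the number of positive / negative entries -/

section SignVarCounts

/-- A sign change `a b < 0` needs a negative entry among `a, b`. [folklore] -/
private theorem ite_mul_neg_le_neg (a b : ℝ) :
    (if a * b < 0 then 1 else 0) ≤ (if a < 0 then 1 else 0) + (if b < 0 then 1 else 0) := by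
  split_ifs with h1 h2 h3 <;> first | omega | (exfalso; nlinarith)

/-- A sign change `a b < 0` needs a positive entry among `a, b`. [folklore] -/
private theorem ite_mul_neg_le_pos (a b : ℝ) :
    (if a * b < 0 then 1 else 0) ≤ (if 0 < a then 1 else 0) + (if 0 < b then 1 else 0) := by
  split_ifs with h1 h2 h3 <;> first | omega | (exfalso; nlinarith)

/-- `#sign changes + [head < 0] ≤ 2 · #negative entries` ("its sign variation is at most
`2 min{n₊, n₋}`", proof of Thm. 3.3, p0009:L69). [cite: BihanDickenstein2017, Thm. 3.3 (proof)] -/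
theorem signVarAux_cons_add_le_two_mul_countP_neg (a : ℝ) (l : List ℝ) :
    signVarAux (a :: l) + (if a < 0 then 1 else 0) ≤
      2 * (a :: l).countP (fun x => decide (x < 0)) := by
  induction l generalizing a with
  | nil =>
    simp only [signVarAux, List.countP_cons, List.countP_nil, decide_eq_true_eq]
    split_ifs <;> omega
  | cons b l ih =>
    have hb := ih b
    have hab := ite_mul_neg_le_neg a b
    rw [show signVarAux (a :: b :: l) = (if a * b < 0 then 1 else 0) + signVarAux (b :: l) from rfl]
    rw [List.countP_cons (a := a)]
    simp only [decide_eq_true_eq] at hb ⊢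
    omega

/-- `#sign changes + [head > 0] ≤ 2 · #positive entries` ("its sign variation is at most
`2 min{n₊, n₋}`", proof of Thm. 3.3, p0009:L69). [cite: BihanDickenstein2017, Thm. 3.3 (proof)] -/
theorem signVarAux_cons_add_le_two_mul_countP_pos (a : ℝ) (l : List ℝ) :
    signVarAux (a :: l) + (if 0 < a then 1 else 0) ≤
      2 * (a :: l).countP (fun x => decide (0 < x)) := by
  induction l generalizing a with
  | nil =>
    simp only [signVarAux, List.countP_cons, List.countP_nil, decide_eq_true_eq]
    split_ifs <;> omega
  | cons b l ih =>
    have hb := ih b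
    have hab := ite_mul_neg_le_pos a b
    rw [show signVarAux (a :: b :: l) = (if a * b < 0 then 1 else 0) + signVarAux (b :: l) from rfl]
    rw [List.countP_cons (a := a)]
    simp only [decide_eq_true_eq] at hb ⊢
    omega

/-- `Var(s) ≤ 2 · #{negative entries of s}` ("its sign variation is at most `2 min{n₊, n₋}`", proof
of Thm. 3.3, p0009:L69). [cite: BihanDickenstein2017, Thm. 3.3 (proof)] -/
theorem signVar_le_two_mul_countP_neg (l : List ℝ) :
    signVar l ≤ 2 * l.countP (fun x => decide (x < 0)) := by
  unfold Literature.Algebra.Polynomial.signVar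
  have h1 : signVarAux (l.filter (fun a => a ≠ 0)) ≤
      2 * (l.filter (fun a => a ≠ 0)).countP (fun x => decide (x < 0)) := by
    cases hl : l.filter (fun a => a ≠ 0) with
    | nil => simp [signVarAux]
    | cons a l' => have := signVarAux_cons_add_le_two_mul_countP_neg a l'; omega
  exact h1.trans (Nat.mul_le_mul_left 2 List.filter_sublist.countP_le)

/-- `Var(s) ≤ 2 · #{positive entries of s}` ("its sign variation is at most `2 min{n₊, n₋}`", proof
of Thm. 3.3, p0009:L69). [cite: BihanDickenstein2017, Thm. 3.3 (proof)] -/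
theorem signVar_le_two_mul_countP_pos (l : List ℝ) :
    signVar l ≤ 2 * l.countP (fun x => decide (0 < x)) := by
  unfold Literature.Algebra.Polynomial.signVar
  have h1 : signVarAux (l.filter (fun a => a ≠ 0)) ≤
      2 * (l.filter (fun a => a ≠ 0)).countP (fun x => decide (0 < x)) := by
    cases hl : l.filter (fun a => a ≠ 0) with
    | nil => simp [signVarAux]
    | cons a l' => have := signVarAux_cons_add_le_two_mul_countP_pos a l'; omega
  exact h1.trans (Nat.mul_le_mul_left 2 List.filter_sublist.countP_le)

/-- The nonzero entries are the positive ones and the negative ones. [folklore] -/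
private theorem countP_ne_zero_eq_add (l : List ℝ) :
    l.countP (fun x => decide (x ≠ 0)) =
      l.countP (fun x => decide (0 < x)) + l.countP (fun x => decide (x < 0)) := by
  induction l with
  | nil => simp
  | cons a l ih =>
    simp only [List.countP_cons, ih, decide_eq_true_eq]
    rcases lt_trichotomy a 0 with h | h | h
    · simp [h, h.ne, not_lt.mpr h.le]
      omega
    · simp [h]
    · simp [h, h.ne', not_lt.mpr h.le]
      omega

/-- `Var(s) ≤ #{positive entries} + #{negative entries} − 1` (a sequence with `m` nonzero entries has
at most `m − 1` sign changes; "If `min{n₊, n₋} = σ(𝒜)`, then `n₊ = n₋ = σ(𝒜)` and then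
`sgnvar(λ̄_0, …, λ̄_{k−1}) ≤ 2σ(𝒜) − 1`", proof of Thm. 3.3, p0009:L71–L72).
[cite: BihanDickenstein2017, Thm. 3.3 (proof)] -/
theorem signVar_le_countP_add_countP_sub_one (l : List ℝ) :
    signVar l ≤ l.countP (fun x => decide (0 < x)) + l.countP (fun x => decide (x < 0)) - 1 := by
  unfold Literature.Algebra.Polynomial.signVar
  refine (signVarAux_le_length_sub_one _).trans ?_
  rw [← countP_ne_zero_eq_add, List.countP_eq_length_filter]

/-- `countP` over `List.ofFn` is a `Finset.filter` cardinality. [folklore] -/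
private theorem countP_ofFn_eq_card_filter {k : ℕ} (g : Fin k → ℝ) (p : ℝ → Prop) [DecidablePred p] :
    (List.ofFn g).countP (fun x => decide (p x)) = (univ.filter fun i => p (g i)).card := by
  classical
  rw [List.ofFn_eq_map, List.countP_map, List.countP_eq_length_filter]
  have hset : ((List.finRange k).filter ((fun x => decide (p x)) ∘ g)).toFinset =
      univ.filter (fun i => p (g i)) := by
    ext i
    simp
  rw [← List.toFinset_card_of_nodup ((List.nodup_finRange k).filter _), hset]

end SignVarCounts

namespace BD17

variable {n : ℕ}

/-! ### Lemma 2.2: `C` is not a pyramid; minors and linear independence of columns -/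

/-- **Lemma 2.2 (i)** (p0005:L110, proof p0006:L1–L8): a rank-`n` matrix `C ∈ ℝ^{n×(n+2)}` with a
positive kernel vector "is not a pyramid, that is, `rk(C(i)) = n` for any `i ∈ [n+2]`": the columns
other than the `i`-th one span `ℝ^n`. [cite: BihanDickenstein2017, Lemma 2.2 (i)] -/
theorem span_cols_erase_eq_top (C : Matrix (Fin n) (Fin (n + 2)) ℝ) (hrk : C.rank = n)
    (hcone : PosConeCond C) (i : Fin (n + 2)) :
    Submodule.span ℝ (Cᵀ '' {m | m ≠ i}) = ⊤ := by
  have htop : Submodule.span ℝ (Set.range Cᵀ) = ⊤ := by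
    apply Submodule.eq_top_of_finrank_eq
    rw [Module.finrank_fin_fun]
    rw [Matrix.rank_eq_finrank_span_cols] at hrk
    exact hrk
  apply le_antisymm le_top
  rw [← htop, Submodule.span_le]
  rintro _ ⟨m, rfl⟩
  by_cases hm : m = i
  · subst hm
    obtain ⟨u, hupos, hu⟩ := hcone
    have hsum : ∑ j, u j • Cᵀ j = 0 := by
      funext r
      have := congr_fun hu r
      simpa [Matrix.mulVec, dotProduct, Finset.sum_apply, mul_comm] using this
    rw [← Finset.add_sum_erase _ _ (Finset.mem_univ m)] at hsum
    have hcol : Cᵀ m = -(u m)⁻¹ • ∑ j ∈ univ.erase m, u j • Cᵀ j := by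
      have hum : u m ≠ 0 := (hupos m).ne'
      rw [← eq_neg_iff_add_eq_zero] at hsum
      rw [neg_smul, ← smul_neg, ← hsum, smul_smul, inv_mul_cancel₀ hum, one_smul]
    rw [hcol]
    refine Submodule.smul_mem _ _ (Submodule.sum_mem _ fun j hj => Submodule.smul_mem _ _ ?_)
    exact Submodule.subset_span ⟨j, Finset.ne_of_mem_erase hj, rfl⟩
  · exact Submodule.subset_span ⟨m, hm, rfl⟩

/-- A maximal `n × n` minor of `C` on the column set `S` is nonzero iff the columns indexed by `S` are
linearly independent ("`rk(C(j₁, j₂)) = n`", the dictionary used throughout Lemma 2.2 and its proof,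
p0005:L110–L115, p0006:L9–L19). [cite: BihanDickenstein2017, Lemma 2.2 (proof)] -/
theorem det_submatrix_orderEmbOfFin_ne_zero_iff (C : Matrix (Fin n) (Fin (n + 2)) ℝ)
    (S : Finset (Fin (n + 2))) (h : S.card = n) :
    (C.submatrix id (S.orderEmbOfFin h)).det ≠ 0 ↔ LinearIndepOn ℝ Cᵀ (S : Set (Fin (n + 2))) := by
  rw [← isUnit_iff_ne_zero, ← Matrix.isUnit_iff_isUnit_det,
    ← Matrix.linearIndependent_cols_iff_isUnit]
  have hcol : (C.submatrix id (S.orderEmbOfFin h)).col =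
      (fun m : (S : Set (Fin (n + 2))) => Cᵀ (m : Fin (n + 2))) ∘ (S.orderIsoOfFin h).toEquiv := by
    funext t r
    simp only [Matrix.col, Matrix.transpose_apply, Matrix.submatrix_apply, id, Function.comp_apply]
    rw [← Finset.coe_orderIsoOfFin_apply]
    rfl
  rw [hcol, linearIndependent_equiv]
  rfl

/-- `det C(i,j) ≠ 0` iff the `n` columns of `C` off `{i, j}` are linearly independent (`i ≠ j`).
[cite: BihanDickenstein2017, §2.2] -/
theorem coeffMinor_ne_zero_iff (C : Matrix (Fin n) (Fin (n + 2)) ℝ) {i j : Fin (n + 2)}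
    (hij : i ≠ j) :
    coeffMinor C i j ≠ 0 ↔
      LinearIndepOn ℝ Cᵀ (↑((Finset.univ : Finset (Fin (n + 2))) \ {i, j}) : Set (Fin (n + 2))) := by
  rw [coeffMinor, dif_neg hij]
  exact det_submatrix_orderEmbOfFin_ne_zero_iff C _ _

/-- `det C(i,j) = 0 ↔ det C(j,i) = 0` (the same submatrix). [cite: BihanDickenstein2017, §2.2] -/
theorem coeffMinor_eq_zero_comm (C : Matrix (Fin n) (Fin (n + 2)) ℝ) (i j : Fin (n + 2)) :
    coeffMinor C i j = 0 ↔ coeffMinor C j i = 0 := by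
  by_cases hij : i = j
  · subst hij
    exact Iff.rfl
  · have h1 := coeffMinor_ne_zero_iff C hij
    have h2 := coeffMinor_ne_zero_iff C (Ne.symm hij)
    rw [Finset.pair_comm j i] at h2
    rw [← not_iff_not]
    exact h1.trans h2.symm

/-- The column set `[n+2] ∖ {a, l}` is `{b} ⊔ ([n+2] ∖ {a, b, l})` for distinct `a, b, l`. [folklore] -/
private theorem coe_univ_sdiff_pair_eq_insert {a b l : Fin (n + 2)} (hab : a ≠ b) (hbl : b ≠ l) :
    (↑((Finset.univ : Finset (Fin (n + 2))) \ {a, l}) : Set (Fin (n + 2))) =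
      insert b {m | m ≠ a ∧ m ≠ b ∧ m ≠ l} := by
  ext m
  simp only [Finset.coe_sdiff, Finset.coe_univ, Finset.coe_insert, Finset.coe_singleton,
    Set.mem_sdiff, Set.mem_univ, Set.mem_insert_iff, Set.mem_singleton_iff, true_and, not_or,
    Set.mem_setOf_eq]
  constructor
  · rintro ⟨hma, hml⟩
    by_cases hmb : m = b
    · exact Or.inl hmb
    · exact Or.inr ⟨hma, hmb, hml⟩
  · rintro (rfl | ⟨hma, hmb, hml⟩)
    · exact ⟨hab.symm, hbl⟩
    · exact ⟨hma, hml⟩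

/-- If the columns off `{a, b, l}` are independent and `det C(a, l) = 0`, then the column `b` lies in
the span of the columns off `{a, b, l}` (proof of Lemma 2.2 (iii)). [cite: BihanDickenstein2017, Lemma 2.2 (proof)] -/
private theorem col_mem_span_of_coeffMinor_eq_zero (C : Matrix (Fin n) (Fin (n + 2)) ℝ)
    {a b l : Fin (n + 2)} (hab : a ≠ b) (hbl : b ≠ l) (hal : a ≠ l)
    (hT : LinearIndepOn ℝ Cᵀ {m | m ≠ a ∧ m ≠ b ∧ m ≠ l}) (h0 : coeffMinor C a l = 0) :
    Cᵀ b ∈ Submodule.span ℝ (Cᵀ '' {m | m ≠ a ∧ m ≠ b ∧ m ≠ l}) := by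
  have hbT : b ∉ {m : Fin (n + 2) | m ≠ a ∧ m ≠ b ∧ m ≠ l} := fun h => h.2.1 rfl
  have hdep : ¬ LinearIndepOn ℝ Cᵀ (insert b {m | m ≠ a ∧ m ≠ b ∧ m ≠ l}) := by
    rw [← coe_univ_sdiff_pair_eq_insert hab hbl, ← coeffMinor_ne_zero_iff C hal]
    exact fun h => h h0
  rw [linearIndepOn_insert hbT] at hdep
  by_contra hb
  exact hdep ⟨hT, hb⟩

/-- **Lemma 2.2 (iii)** (p0005:L115, proof p0006:L14–L19): if `rk C(j₁, j₂) = n` then, for any other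
index `i`, `rk C(j₁, i) = n` or `rk C(j₂, i) = n` — for a matrix that is not a pyramid (Lemma 2.2 (i)).
[cite: BihanDickenstein2017, Lemma 2.2 (iii)] -/
theorem coeffMinor_ne_zero_or (C : Matrix (Fin n) (Fin (n + 2)) ℝ)
    (hC : ∀ i : Fin (n + 2), Submodule.span ℝ (Cᵀ '' {m | m ≠ i}) = ⊤)
    {p q l : Fin (n + 2)} (hpq : p ≠ q) (hmin : coeffMinor C p q ≠ 0) (hlp : l ≠ p) (hlq : l ≠ q) :
    coeffMinor C p l ≠ 0 ∨ coeffMinor C q l ≠ 0 := by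
  by_contra h
  push Not at h
  obtain ⟨hpl, hql⟩ := h
  -- the columns off `{p, q}` are independent, hence so are those off `{p, q, l}`
  have hS := (coeffMinor_ne_zero_iff C hpq).mp hmin
  have hTsub : ({m | m ≠ p ∧ m ≠ q ∧ m ≠ l} : Set (Fin (n + 2))) ⊆
      (↑((Finset.univ : Finset (Fin (n + 2))) \ {p, q}) : Set (Fin (n + 2))) := by
    intro m hm
    simp only [Finset.coe_sdiff, Finset.coe_univ, Finset.coe_insert, Finset.coe_singleton,
      Set.mem_sdiff, Set.mem_univ, Set.mem_insert_iff, Set.mem_singleton_iff, true_and, not_or]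
    exact ⟨hm.1, hm.2.1⟩
  have hTind : LinearIndepOn ℝ Cᵀ {m | m ≠ p ∧ m ≠ q ∧ m ≠ l} := hS.mono hTsub
  -- `C(p, l)` singular ⇒ column `q` lies in the span `H` of the columns off `{p, q, l}`; same for `p`
  have hq : Cᵀ q ∈ Submodule.span ℝ (Cᵀ '' {m | m ≠ p ∧ m ≠ q ∧ m ≠ l}) :=
    col_mem_span_of_coeffMinor_eq_zero C hpq hlq.symm hlp.symm hTind hpl
  have hT' : ({m | m ≠ q ∧ m ≠ p ∧ m ≠ l} : Set (Fin (n + 2))) = {m | m ≠ p ∧ m ≠ q ∧ m ≠ l} := by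
    ext m
    simp only [Set.mem_setOf_eq]
    tauto
  have hp : Cᵀ p ∈ Submodule.span ℝ (Cᵀ '' {m | m ≠ p ∧ m ≠ q ∧ m ≠ l}) := by
    have h := col_mem_span_of_coeffMinor_eq_zero C hpq.symm hlp.symm hlq.symm (hT'.symm ▸ hTind) hql
    rwa [hT'] at h
  -- hence all columns off `l` lie in `H`, so `H = ℝ^n` (no pyramid at `l`)
  have hle : (⊤ : Submodule ℝ (Fin n → ℝ)) ≤
      Submodule.span ℝ (Cᵀ '' {m | m ≠ p ∧ m ≠ q ∧ m ≠ l}) := by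
    rw [← hC l, Submodule.span_le]
    rintro _ ⟨m, hm, rfl⟩
    by_cases hmp : m = p
    · rw [hmp]; exact hp
    by_cases hmq : m = q
    · rw [hmq]; exact hq
    exact Submodule.subset_span ⟨m, ⟨hmp, hmq, hm⟩, rfl⟩
  -- but `H` is spanned by `n - 1` vectors
  have hTF : ({m | m ≠ p ∧ m ≠ q ∧ m ≠ l} : Set (Fin (n + 2))) =
      (↑((Finset.univ : Finset (Fin (n + 2))) \ {p, q, l}) : Set (Fin (n + 2))) := by
    ext m
    simp [not_or]
  have h3 : ({p, q, l} : Finset (Fin (n + 2))).card = 3 := by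
    rw [Finset.card_insert_of_notMem (by simp [hpq, hlp.symm]), Finset.card_pair hlq.symm]
  have hcard : ((Finset.univ : Finset (Fin (n + 2))) \ {p, q, l}).card = n - 1 := by
    rw [Finset.card_sdiff_of_subset (Finset.subset_univ _), Finset.card_univ, Fintype.card_fin, h3]
    omega
  have hfin : Module.finrank ℝ (Submodule.span ℝ (Cᵀ '' {m | m ≠ p ∧ m ≠ q ∧ m ≠ l})) ≤ n - 1 := by
    classical
    rw [hTF, ← Finset.coe_image]
    exact (finrank_span_finset_le_card _).trans (Finset.card_image_le.trans hcard.le)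
  have htop : Module.finrank ℝ (⊤ : Submodule ℝ (Fin n → ℝ)) = n := by
    rw [finrank_top, Module.finrank_fin_fun]
  have h3' : 3 ≤ n + 2 := by
    have := Finset.card_le_univ ({p, q, l} : Finset (Fin (n + 2)))
    rw [h3, Fintype.card_fin] at this
    exact this
  have := Submodule.finrank_mono hle
  omega

/-! ### The restricted ordering `ᾱ`, the classes `K_j`, and the counts `n₊ ≤ a₊`, `n₋ ≤ a₋` -/

/-- `ᾱ` takes values in `K` ("the bijection `[k] → K` which is deduced from `α`", p0007:L11).
[cite: BihanDickenstein2017, §2.3] -/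
theorem restrictOrdering_mem (α : Equiv.Perm (Fin (n + 2))) (K : Finset (Fin (n + 2)))
    (t : Fin K.card) : restrictOrdering α K t ∈ K := by
  unfold restrictOrdering
  have h := Finset.orderEmbOfFin_mem (K.map α.symm.toEmbedding) (Finset.card_map _) t
  rw [Finset.mem_map] at h
  obtain ⟨k, hk, hk'⟩ := h
  rw [← hk']
  simpa using hk

/-- `ᾱ : [k] → K` is injective (a bijection onto `K`). [cite: BihanDickenstein2017, §2.3] -/
theorem restrictOrdering_injective (α : Equiv.Perm (Fin (n + 2))) (K : Finset (Fin (n + 2))) :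
    Function.Injective (restrictOrdering α K) := fun _ _ hst =>
  (Finset.orderEmbOfFin _ _).injective (α.injective hst)

/-- The classes `K_j` (2.12) are pairwise disjoint ("we get a partition `⊔_{j∈[k]} K_j = [n+2]` by
the maximality of `K` and Lemma 2.2", p0007:L23) — here from `det C(i,j) ≠ 0` on `K` and Lemma 2.2
(iii) for a matrix that is not a pyramid. [cite: BihanDickenstein2017, §2.3 eq. (2.12)] -/
theorem disjoint_minorClass (C : Matrix (Fin n) (Fin (n + 2)) ℝ)
    (hC : ∀ i : Fin (n + 2), Submodule.span ℝ (Cᵀ '' {m | m ≠ i}) = ⊤)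
    {K : Finset (Fin (n + 2))} (hK : MinorsNonzeroOn C K) (α : Equiv.Perm (Fin (n + 2)))
    {j j' : Fin K.card} (hjj' : j ≠ j') :
    Disjoint (minorClass C K α j) (minorClass C K α j') := by
  rw [Finset.disjoint_left]
  intro l hl hl'
  simp only [minorClass, Finset.mem_filter, Finset.mem_univ, true_and] at hl hl'
  have hpq : restrictOrdering α K j ≠ restrictOrdering α K j' :=
    fun h => hjj' (restrictOrdering_injective α K h)
  have hmin : coeffMinor C (restrictOrdering α K j) (restrictOrdering α K j') ≠ 0 :=
    hK _ (restrictOrdering_mem α K j) _ (restrictOrdering_mem α K j') hpq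
  by_cases hlp : l = restrictOrdering α K j
  · rcases hl' with h | h
    · exact hpq (hlp.symm.trans h)
    · rw [hlp, coeffMinor_eq_zero_comm] at h
      exact hmin h
  by_cases hlq : l = restrictOrdering α K j'
  · rcases hl with h | h
    · exact hlp h
    · rw [hlq] at h
      exact hmin h
  rcases hl with h | h
  · exact hlp h
  rcases hl' with h' | h'
  · exact hlq h'
  rcases coeffMinor_ne_zero_or C hC hpq hmin hlp hlq with h1 | h1
  · exact h1 h
  · exact h1 h'

/-- "the number `n₊` of positive terms in the sequence `(λ̄_0, …, λ̄_{k−1})` is at most `a₊`" (proof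
of Thm. 3.3, p0009:L64–L68): a positive class sum `λ̄_j = ∑_{ℓ ∈ K_j} λ_ℓ` contains a positive
`λ_ℓ`, and the classes are disjoint. [cite: BihanDickenstein2017, Thm. 3.3 (proof)] -/
theorem card_filter_lambdaBar_pos_le_sigPos (w : Fin (n + 2) → Fin n → ℤ)
    (C : Matrix (Fin n) (Fin (n + 2)) ℝ) (K : Finset (Fin (n + 2))) (α : Equiv.Perm (Fin (n + 2)))
    (hdisj : ∀ j j' : Fin K.card, j ≠ j' → Disjoint (minorClass C K α j) (minorClass C K α j')) :
    (univ.filter fun j => 0 < lambdaBar w C K α j).card ≤ sigPos w := by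
  have hex : ∀ j ∈ univ.filter (fun j => 0 < lambdaBar w C K α j),
      ∃ l ∈ minorClass C K α j, 0 < affRel w l := by
    intro j hj
    rw [Finset.mem_filter] at hj
    by_contra h
    push Not at h
    have hle : lambdaBar w C K α j ≤ 0 := Finset.sum_nonpos h
    exact absurd hle (not_le.mpr hj.2)
  choose! f hf using hex
  refine Finset.card_le_card_of_injOn f (fun j hj => ?_) (fun j hj j' hj' hjj' => ?_)
  · exact Finset.mem_filter.mpr ⟨Finset.mem_univ _, (hf j hj).2⟩
  · by_contra hne
    exact Finset.disjoint_left.mp (hdisj j j' hne) (hf j hj).1 (hjj' ▸ (hf j' hj').1)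

/-- "the number `n₋` of negative terms … is at most `a₋`" (proof of Thm. 3.3, p0009:L64–L68).
[cite: BihanDickenstein2017, Thm. 3.3 (proof)] -/
theorem card_filter_lambdaBar_neg_le_sigNeg (w : Fin (n + 2) → Fin n → ℤ)
    (C : Matrix (Fin n) (Fin (n + 2)) ℝ) (K : Finset (Fin (n + 2))) (α : Equiv.Perm (Fin (n + 2)))
    (hdisj : ∀ j j' : Fin K.card, j ≠ j' → Disjoint (minorClass C K α j) (minorClass C K α j')) :
    (univ.filter fun j => lambdaBar w C K α j < 0).card ≤ sigNeg w := by
  have hex : ∀ j ∈ univ.filter (fun j => lambdaBar w C K α j < 0),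
      ∃ l ∈ minorClass C K α j, affRel w l < 0 := by
    intro j hj
    rw [Finset.mem_filter] at hj
    by_contra h
    push Not at h
    have hle : 0 ≤ lambdaBar w C K α j := Finset.sum_nonneg h
    exact absurd hle (not_le.mpr hj.2)
  choose! f hf using hex
  refine Finset.card_le_card_of_injOn f (fun j hj => ?_) (fun j hj j' hj' hjj' => ?_)
  · exact Finset.mem_filter.mpr ⟨Finset.mem_univ _, (hf j hj).2⟩
  · by_contra hne
    exact Finset.disjoint_left.mp (hdisj j j' hne) (hf j hj).1 (hjj' ▸ (hf j' hj').1)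

/-- A maximal (under containment) subset `K ⊂ [n+2]` with `det C(i,j) ≠ 0` for distinct `i, j ∈ K`
exists (take one of maximal cardinality). [cite: BihanDickenstein2017, §2.3] -/
theorem exists_isMaxMinorSet (C : Matrix (Fin n) (Fin (n + 2)) ℝ) : ∃ K, IsMaxMinorSet C K := by
  classical
  obtain ⟨K, hK, hmax⟩ := Finset.exists_max_image (univ.filter fun K => MinorsNonzeroOn C K)
    Finset.card ⟨∅, by simp [MinorsNonzeroOn]⟩
  refine ⟨K, (Finset.mem_filter.mp hK).2, fun K' hlt hK' => ?_⟩
  have h := hmax K' (Finset.mem_filter.mpr ⟨Finset.mem_univ _, hK'⟩)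
  exact absurd (Finset.card_lt_card hlt) (not_lt.mpr h)

/-- For a circuit (`λ_j ≠ 0` for all `j`), `a₊ + a₋ = n + 2` ("As `a₊ + a₋ = n+2`", p0009:L77).
[cite: BihanDickenstein2017, Thm. 3.3 (proof)] -/
theorem sigPos_add_sigNeg (w : Fin (n + 2) → Fin n → ℤ) (hcirc : IsCircuit w) :
    sigPos w + sigNeg w = n + 2 := by
  unfold sigPos sigNeg
  have hfilter : (univ.filter fun ℓ => affRel w ℓ < 0) = univ.filter (fun ℓ => ¬ 0 < affRel w ℓ) := by
    ext ℓ
    simp only [Finset.mem_filter, Finset.mem_univ, true_and, not_lt]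
    exact ⟨fun h => h.le, fun h => lt_of_le_of_ne h (hcirc ℓ)⟩
  rw [hfilter, Finset.card_filter_add_card_filter_not, Finset.card_univ, Fintype.card_fin]

end BD17

open BD17

/-! ### Thm. 3.3 from Thm. 2.9 -/

/-- **BD 2017, Thm. 3.3 follows from Thm. 2.9** (with Prop. 2.6, now a theorem of the tree, supplying
the ordering): the signature bound `n_𝒜(C) ≤ 2σ(𝒜)` (`2σ(𝒜) − 1` if `a₊ = a₋`) and the necessary
conditions for `n_𝒜(C) = n + 1` (`C` uniform, maximal signature). Proof as printed (p0009:L59–L84):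
`n_𝒜(C) ≤ sgnvar(λ̄_0, …, λ̄_{k−1})` by (2.15); `n₊ ≤ a₊`, `n₋ ≤ a₋` by the disjointness of the
classes `K_j`; `sgnvar ≤ 2 min{n₊, n₋}`, and `≤ n₊ + n₋ − 1`; for `n_𝒜(C) = n + 1`, also
`sgnvar ≤ k − 1` forces `k = n + 2`. [cite: BihanDickenstein2017, Thm. 3.3] -/
theorem BD2017_thm_3_3_of_thm_2_9 (h29 : BD2017_thm_2_9) : BD2017_thm_3_3 := by
  intro n w C hrk hcone hcirc hfin
  obtain ⟨α, hα⟩ := BD2017_prop_2_6_holds n C hrk.2 hcone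
  obtain ⟨K, hK⟩ := exists_isMaxMinorSet C
  have h15 := (h29 n w C hrk hcone hcirc α hα K hK hfin).1
  have hC := span_cols_erase_eq_top C hrk.2 hcone
  have hdisj : ∀ j j' : Fin K.card, j ≠ j' →
      Disjoint (minorClass C K α j) (minorClass C K α j') :=
    fun j j' h => disjoint_minorClass C hC hK.1 α h
  -- the counts `n₊`, `n₋` of the sequence `s_α`
  have hVp : signVar (sAlpha w C K α) ≤
      2 * (univ.filter fun j : Fin K.card => 0 < lambdaBar w C K α j).card := by
    have h := signVar_le_two_mul_countP_pos (sAlpha w C K α)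
    rw [sAlpha, countP_ofFn_eq_card_filter] at h
    simpa only [sAlpha, Int.cast_pos] using h
  have hVn : signVar (sAlpha w C K α) ≤
      2 * (univ.filter fun j : Fin K.card => lambdaBar w C K α j < 0).card := by
    have h := signVar_le_two_mul_countP_neg (sAlpha w C K α)
    rw [sAlpha, countP_ofFn_eq_card_filter] at h
    simpa only [sAlpha, Int.cast_lt_zero] using h
  have hV1 : signVar (sAlpha w C K α) ≤
      (univ.filter fun j : Fin K.card => 0 < lambdaBar w C K α j).card +
        (univ.filter fun j : Fin K.card => lambdaBar w C K α j < 0).card - 1 := by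
    have h := signVar_le_countP_add_countP_sub_one (sAlpha w C K α)
    rw [sAlpha, countP_ofFn_eq_card_filter, countP_ofFn_eq_card_filter] at h
    simpa only [sAlpha, Int.cast_pos, Int.cast_lt_zero] using h
  have hnp := card_filter_lambdaBar_pos_le_sigPos w C K α hdisj
  have hnm := card_filter_lambdaBar_neg_le_sigNeg w C K α hdisj
  have hsum := sigPos_add_sigNeg w hcirc
  have hbound : numPosSols w C ≤
      if sigPos w ≠ sigNeg w then 2 * sigma w else 2 * sigma w - 1 := by
    unfold sigma
    split_ifs with hne
    · rcases le_total (sigPos w) (sigNeg w) with h | h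
      · rw [min_eq_left h]
        omega
      · rw [min_eq_right h]
        omega
    · push Not at hne
      rw [hne, min_self]
      omega
  refine ⟨hbound, fun hN => ?_⟩
  -- `n_𝒜(C) = n + 1`: then `k = n + 2`, i.e. `C` is uniform, and the signature is maximal
  have hk : K.card ≤ n + 2 := by simpa using Finset.card_le_univ K
  have hVk : signVar (sAlpha w C K α) ≤ K.card - 1 := by
    rw [← BD17.length_sAlpha w C K α]
    exact signVar_le_length_sub_one _
  have hKcard : K.card = n + 2 := by omega
  have hKuniv : K = univ := Finset.eq_univ_of_card K (by rw [hKcard, Fintype.card_fin])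
  refine ⟨fun i j hij => hK.1 i (hKuniv ▸ Finset.mem_univ i) j (hKuniv ▸ Finset.mem_univ j) hij, ?_⟩
  have key : (sigPos w = (n + 2) / 2 ∧ sigNeg w = n + 2 - (n + 2) / 2) ∨
      (sigNeg w = (n + 2) / 2 ∧ sigPos w = n + 2 - (n + 2) / 2) := by
    unfold sigma at hbound
    rw [hN] at hbound
    split_ifs at hbound with hne
    · rcases le_total (sigPos w) (sigNeg w) with h | h
      · rw [min_eq_left h] at hbound
        omega
      · rw [min_eq_right h] at hbound
        omega
    · push Not at hne
      rw [hne, min_self] at hbound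
      omega
  rcases key with ⟨h1, h2⟩ | ⟨h1, h2⟩
  · rw [h1, h2]
  · rw [Finset.pair_comm, h1, h2]


/-- **BD 2017, Cor. 3.1 from Thm. 2.9 alone** (`n_𝒜(C) ≤ k − 1`): the tree's
`BD2017_cor_3_1_of_thm_2_9` with the ordering supplied by `BD2017_prop_2_6_holds`.
[cite: BihanDickenstein2017, Cor. 3.1] -/
theorem BD2017_cor_3_1_of_thm_2_9' (h29 : BD2017_thm_2_9) : BD2017_cor_3_1 :=
  BD2017_cor_3_1_of_thm_2_9 h29 BD2017_prop_2_6_holds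

/-- **BD 2017, Cor. 3.4 from Thm. 2.9 alone** (simplex plus one interior point: `n_𝒜(C) ≤ 2`): the
tree's `BD2017_cor_3_4_of_thm_3_3` after `BD2017_thm_3_3_of_thm_2_9`.
[cite: BihanDickenstein2017, Cor. 3.4] -/
theorem BD2017_cor_3_4_of_thm_2_9 (h29 : BD2017_thm_2_9) : BD2017_cor_3_4 :=
  BD2017_cor_3_4_of_thm_3_3 (BD2017_thm_3_3_of_thm_2_9 h29)

end Literature.Computability.AlgebraicComplexity
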